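import Summits.Ventures.YMGap.RobustBall.HaarSecondMoments
import HarnessLib

/-!
# The Haar FOURTH moment of the `SU(2)` character: `∫ (Re tr U)⁴ dU = 2`, i.e. `E[(½ Re tr U_p)⁴] = 1/8`
# (row type C-PRESS, endpoint `β = 0`, part 10: the input of the fourth Balian–Drouffe–Itzykson coefficient)

Cell `pub-ymgap`, seat ds-1 (gen 11). HONEST FRAMING: pure compact-group integration for a compact group `G ≅ SU(2)`
(`IsSpecialUnitaryModel ρ`, the tree's standing hypothesis for the gauge group); nothing lattice-specific, nothing about the
continuum or the Clay problem. Kernel theorems only, 0 compute, no definitions.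

Write the first row of `ρ(g) ∈ SU(2)` as the unit quaternion `x = (x₀, x₁, x₂, x₃) = (Re U₀₀, Im U₀₀, Re U₀₁, Im U₀₁)`
(`su2Quat`, `quatMatrix_su2Quat` of `Literature/…/SU2Haar`), so that `Re tr ρ(g) = 2x₀` and `Σ x_a² = 1`.
Left multiplication by the special unitary matrix `quatMatrix q` of a unit quaternion `q` acts on `x` by quaternion
multiplication (`quatMatrix_mul_apply`), so Haar invariance (`RobustBall.HaarSecondMoments.integral_comp_mul_left`) gives
`∫ F(q·x) dg = ∫ F(x) dg` (`integral_comp_quat`). Nine explicit unit quaternions suffice: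
* `q = i, j, k`: `∫ x_a⁴ = ∫ x₀⁴ =: m₄` (`integral_im00_pow_four`, `integral_re01_pow_four`, `integral_im01_pow_four`);
* `q = (3 ± 4e_a)/5`: `∫ ((3x₀ ∓ 4x_a)/5)⁴ = m₄`; adding the two signs kills the odd moments and leaves
  `162 m₄ + 1728 ∫ x₀²x_a² + 512 m₄ = 1250 m₄`, i.e. **`∫ x₀² x_a² = m₄/3`** (`integral_re00_sq_mul_sq_*`);
* the unitarity row sum `x₀² + x₁² + x₂² + x₃² = 1` multiplied by `x₀²` and integrated: `m₄ + 3·(m₄/3) = ∫ x₀² = 1/4`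
  (`charVariance_eq_one`: `∫ (Re tr)² = 1`), hence ★ **`m₄ = ∫ (Re U₀₀)⁴ dU = 1/8`** (`integral_re00_pow_four`) and
  ★★ **`∫ (Re tr ρ(g))⁴ dg = 2`** (`integral_reTr_pow_four`; concretely `integral_reTr_pow_four_su2`,
  `integral_half_reTr_pow_four_su2 : ∫ (½ Re tr U)⁴ dU = 1/8`).
This is the fourth moment `C₂/8 = 2/16` of the Sato–Tate / semicircle law of `½ tr U` (density `(2/π)√(1−t²)`), equivalently
the multiplicity `2` of the trivial representation in `V^{⊗4}` for the fundamental `V` of `SU(2)` — obtained here without the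
Weyl integration formula, Peter–Weyl or Weingarten calculus. Also the odd moments vanish: `∫ (Re tr)³ = 0`
(`integral_reTr_pow_three`, centre twist `−1`). USE (ds-1 g10/g11, C-PRESS part 11): under the infinite Haar product
`dg_∞` (THE DLR state at `β = 0`) the fourth cumulant of the `SU(2)` plaquette variable `W_p = ½ Re tr U_p` is
`E W⁴ − 3(E W²)² = 1/8 − 3/16 = −1/16`, the number behind `f⁗(0) = −6` for the strong-coupling free energy density.
References: Balian–Drouffe–Itzykson, Phys. Rev. D 11 (1975) 2104, §III; M. Creutz, *Quarks, gluons and lattices* (1983)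
§8; T. Bröcker, T. tom Dieck, GTM 98 (1985) II §5. Everything here is proved. [folklore]
-/

noncomputable section

open MeasureTheory Complex
open Literature.MathematicalPhysics.QuantumLattice Literature.MathematicalPhysics.QuantumFieldTheory
open scoped Quaternion

namespace Summit.Ventures.YMGap.HaarFourthMoment

section Model

variable {G : Type*} [Group G] [TopologicalSpace G] [IsTopologicalGroup G] [CompactSpace G]
  [MeasurableSpace G] [BorelSpace G] (ρ : G →* Matrix (Fin 2) (Fin 2) ℂ)

omit [IsTopologicalGroup G] [CompactSpace G] [MeasurableSpace G] [BorelSpace G] in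
/-- Every value of the model `ρ : G ≅ SU(2)` is a special unitary matrix. [folklore] -/
theorem mem_SU (hρ : IsSpecialUnitaryModel ρ) (g : G) : ρ g ∈ Matrix.specialUnitaryGroup (Fin 2) ℂ := by
  have h : ρ g ∈ (Matrix.specialUnitaryGroup (Fin 2) ℂ : Set (Matrix (Fin 2) (Fin 2) ℂ)) :=
    hρ.2.2 ▸ Set.mem_range_self g
  exact h

omit [IsTopologicalGroup G] [CompactSpace G] [MeasurableSpace G] [BorelSpace G] in
/-- **The unitarity row sum as a unit quaternion**: `(Re U₀₀)² + (Im U₀₀)² + (Re U₀₁)² + (Im U₀₁)² = 1` for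
`U = ρ(g) ∈ SU(2)`. [folklore] -/
theorem sum_sq_eq_one (hρ : IsSpecialUnitaryModel ρ) (g : G) :
    (ρ g 0 0).re ^ 2 + (ρ g 0 0).im ^ 2 + (ρ g 0 1).re ^ 2 + (ρ g 0 1).im ^ 2 = 1 := by
  have h := normSq_su2Quat ⟨ρ g, mem_SU ρ hρ g⟩
  rw [Quaternion.normSq_def'] at h
  simpa [su2Quat] using h

omit [IsTopologicalGroup G] [CompactSpace G] [MeasurableSpace G] [BorelSpace G] in
/-- **`Re tr ρ(g) = 2 Re ρ(g)₀₀`** for `G ≅ SU(2)` (`U₁₁ = conj U₀₀`). [folklore] -/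
theorem reTr_eq_two_mul (hρ : IsSpecialUnitaryModel ρ) (g : G) :
    PlaquetteLowerBound.reTr ρ g = 2 * (ρ g 0 0).re := by
  have h11 := su2_apply_11 ⟨ρ g, mem_SU ρ hρ g⟩
  change ρ g 1 1 = (starRingEnd ℂ) (ρ g 0 0) at h11
  unfold PlaquetteLowerBound.reTr
  rw [Matrix.trace_fin_two, Complex.add_re, h11, Complex.conj_re]
  ring

omit [IsTopologicalGroup G] [CompactSpace G] [MeasurableSpace G] [BorelSpace G] in
/-- **Left multiplication by `quatMatrix q` is quaternion multiplication on the first row**: for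
`q = a + b i + c j + d k` and `U = ρ(g)` with first-row quaternion `x`, the first row of `quatMatrix q · U` is the
quaternion `q · x`, componentwise. [folklore] -/
theorem quatMatrix_mul_apply (hρ : IsSpecialUnitaryModel ρ) (a b c d : ℝ) (g : G) :
    ((quatMatrix ⟨a, b, c, d⟩ * ρ g) 0 0).re =
        a * (ρ g 0 0).re - b * (ρ g 0 0).im - c * (ρ g 0 1).re - d * (ρ g 0 1).im ∧
      ((quatMatrix ⟨a, b, c, d⟩ * ρ g) 0 0).im =
        a * (ρ g 0 0).im + b * (ρ g 0 0).re + c * (ρ g 0 1).im - d * (ρ g 0 1).re ∧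
      ((quatMatrix ⟨a, b, c, d⟩ * ρ g) 0 1).re =
        a * (ρ g 0 1).re - b * (ρ g 0 1).im + c * (ρ g 0 0).re + d * (ρ g 0 0).im ∧
      ((quatMatrix ⟨a, b, c, d⟩ * ρ g) 0 1).im =
        a * (ρ g 0 1).im + b * (ρ g 0 1).re - c * (ρ g 0 0).im + d * (ρ g 0 0).re := by
  set U : Matrix.specialUnitaryGroup (Fin 2) ℂ := ⟨ρ g, mem_SU ρ hρ g⟩ with hU
  have hρg : ρ g = quatMatrix (su2Quat U) := by rw [quatMatrix_su2Quat]
  rw [hρg, ← quatMatrix_mul]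
  simp only [quatMatrix_apply_00, quatMatrix_apply_01, Quaternion.re_mul, Quaternion.imI_mul,
    Quaternion.imJ_mul, Quaternion.imK_mul, su2Quat, hU]
  exact ⟨trivial, trivial, trivial, trivial⟩

/-- ★ **Haar invariance in quaternion coordinates**: for every unit quaternion `q = (a, b, c, d)` and every function `F`
of the first row `x = (Re U₀₀, Im U₀₀, Re U₀₁, Im U₀₁)` of `U = ρ(g)`, `∫ F(q · x) dg = ∫ F(x) dg`. [folklore] -/
theorem integral_comp_quat (hρ : IsSpecialUnitaryModel ρ) {a b c d : ℝ} (h1 : a ^ 2 + b ^ 2 + c ^ 2 + d ^ 2 = 1)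
    (F : ℝ → ℝ → ℝ → ℝ → ℝ) :
    ∫ g, F (a * (ρ g 0 0).re - b * (ρ g 0 0).im - c * (ρ g 0 1).re - d * (ρ g 0 1).im)
        (a * (ρ g 0 0).im + b * (ρ g 0 0).re + c * (ρ g 0 1).im - d * (ρ g 0 1).re)
        (a * (ρ g 0 1).re - b * (ρ g 0 1).im + c * (ρ g 0 0).re + d * (ρ g 0 0).im)
        (a * (ρ g 0 1).im + b * (ρ g 0 1).re - c * (ρ g 0 0).im + d * (ρ g 0 0).re) ∂haarProbability G =
      ∫ g, F (ρ g 0 0).re (ρ g 0 0).im (ρ g 0 1).re (ρ g 0 1).im ∂haarProbability G := by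
  set q : ℍ := ⟨a, b, c, d⟩ with hq
  have hnq : ‖q‖ = 1 := by
    have hsq : Quaternion.normSq q = 1 := by rw [Quaternion.normSq_def']; simpa [hq] using h1
    rw [Quaternion.normSq_eq_norm_mul_self] at hsq
    nlinarith [norm_nonneg q]
  have h := RobustBall.HaarSecondMoments.integral_comp_mul_left ρ hρ (quatMatrix_mem_specialUnitaryGroup hnq)
    (fun M => F (M 0 0).re (M 0 0).im (M 0 1).re (M 0 1).im)
  have hpt : ∀ g : G, F ((quatMatrix q * ρ g) 0 0).re ((quatMatrix q * ρ g) 0 0).im ((quatMatrix q * ρ g) 0 1).re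
      ((quatMatrix q * ρ g) 0 1).im =
      F (a * (ρ g 0 0).re - b * (ρ g 0 0).im - c * (ρ g 0 1).re - d * (ρ g 0 1).im)
        (a * (ρ g 0 0).im + b * (ρ g 0 0).re + c * (ρ g 0 1).im - d * (ρ g 0 1).re)
        (a * (ρ g 0 1).re - b * (ρ g 0 1).im + c * (ρ g 0 0).re + d * (ρ g 0 0).im)
        (a * (ρ g 0 1).im + b * (ρ g 0 1).re - c * (ρ g 0 0).im + d * (ρ g 0 0).re) := by
    intro g
    obtain ⟨e1, e2, e3, e4⟩ := quatMatrix_mul_apply ρ hρ a b c d g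
    rw [e1, e2, e3, e4]
  simp only [hpt] at h
  exact h

omit [IsTopologicalGroup G] [CompactSpace G] [MeasurableSpace G] [BorelSpace G] in
/-- The four real coordinates of the first row are continuous. [folklore] -/
theorem continuous_coords (hρ : IsSpecialUnitaryModel ρ) :
    Continuous (fun g => (ρ g 0 0).re) ∧ Continuous (fun g => (ρ g 0 0).im) ∧
      Continuous (fun g => (ρ g 0 1).re) ∧ Continuous (fun g => (ρ g 0 1).im) :=
  ⟨Complex.continuous_re.comp (hρ.1.matrix_elem 0 0), Complex.continuous_im.comp (hρ.1.matrix_elem 0 0),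
    Complex.continuous_re.comp (hρ.1.matrix_elem 0 1), Complex.continuous_im.comp (hρ.1.matrix_elem 0 1)⟩

/-! ### Fourth moments of single coordinates: `∫ x_a⁴ = ∫ x₀⁴` (`q = i, j, k`) -/

/-- `∫ (Im U₀₀)⁴ = ∫ (Re U₀₀)⁴` (left twist by `quatMatrix i = diag(i, −i)`). [folklore] -/
theorem integral_im00_pow_four (hρ : IsSpecialUnitaryModel ρ) :
    ∫ g, (ρ g 0 0).im ^ 4 ∂haarProbability G = ∫ g, (ρ g 0 0).re ^ 4 ∂haarProbability G := by
  have h := integral_comp_quat ρ hρ (a := 0) (b := 1) (c := 0) (d := 0) (by norm_num) (fun s _ _ _ => s ^ 4)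
  have hpt : ∀ g : G, ((0 : ℝ) * (ρ g 0 0).re - 1 * (ρ g 0 0).im - 0 * (ρ g 0 1).re - 0 * (ρ g 0 1).im) ^ 4 =
      (ρ g 0 0).im ^ 4 := fun g => by ring
  simp only [hpt] at h
  exact h

/-- `∫ (Re U₀₁)⁴ = ∫ (Re U₀₀)⁴` (left twist by `quatMatrix j`). [folklore] -/
theorem integral_re01_pow_four (hρ : IsSpecialUnitaryModel ρ) :
    ∫ g, (ρ g 0 1).re ^ 4 ∂haarProbability G = ∫ g, (ρ g 0 0).re ^ 4 ∂haarProbability G := by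
  have h := integral_comp_quat ρ hρ (a := 0) (b := 0) (c := 1) (d := 0) (by norm_num) (fun s _ _ _ => s ^ 4)
  have hpt : ∀ g : G, ((0 : ℝ) * (ρ g 0 0).re - 0 * (ρ g 0 0).im - 1 * (ρ g 0 1).re - 0 * (ρ g 0 1).im) ^ 4 =
      (ρ g 0 1).re ^ 4 := fun g => by ring
  simp only [hpt] at h
  exact h

/-- `∫ (Im U₀₁)⁴ = ∫ (Re U₀₀)⁴` (left twist by `quatMatrix k`). [folklore] -/
theorem integral_im01_pow_four (hρ : IsSpecialUnitaryModel ρ) :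
    ∫ g, (ρ g 0 1).im ^ 4 ∂haarProbability G = ∫ g, (ρ g 0 0).re ^ 4 ∂haarProbability G := by
  have h := integral_comp_quat ρ hρ (a := 0) (b := 0) (c := 0) (d := 1) (by norm_num) (fun s _ _ _ => s ^ 4)
  have hpt : ∀ g : G, ((0 : ℝ) * (ρ g 0 0).re - 0 * (ρ g 0 0).im - 0 * (ρ g 0 1).re - 1 * (ρ g 0 1).im) ^ 4 =
      (ρ g 0 1).im ^ 4 := fun g => by ring
  simp only [hpt] at h
  exact h

/-! ### Mixed moments: `∫ x₀² x_a² = (∫ x₀⁴)/3` (the rotations `q = (3 ± 4 e_a)/5`) -/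

/-- The bookkeeping step: from `∫ ((3x₀ − 4y)/5)⁴ = ∫ ((3x₀ + 4y)/5)⁴ = ∫ x₀⁴ = ∫ y⁴` conclude `∫ x₀² y² = (∫ x₀⁴)/3`.
[folklore] -/
theorem integral_sq_mul_sq_of_rotations {x y : G → ℝ} (hx : Continuous x) (hy : Continuous y)
    (hm : ∫ g, ((3 * x g - 4 * y g) / 5) ^ 4 ∂haarProbability G = ∫ g, x g ^ 4 ∂haarProbability G)
    (hp : ∫ g, ((3 * x g + 4 * y g) / 5) ^ 4 ∂haarProbability G = ∫ g, x g ^ 4 ∂haarProbability G)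
    (hy4 : ∫ g, y g ^ 4 ∂haarProbability G = ∫ g, x g ^ 4 ∂haarProbability G) :
    ∫ g, x g ^ 2 * y g ^ 2 ∂haarProbability G = (∫ g, x g ^ 4 ∂haarProbability G) / 3 := by
  have hi1 : Integrable (fun g => ((3 * x g - 4 * y g) / 5) ^ 4) (haarProbability G) :=
    Continuous.integrable_of_hasCompactSupport (by fun_prop) (HasCompactSupport.of_compactSpace _)
  have hi2 : Integrable (fun g => ((3 * x g + 4 * y g) / 5) ^ 4) (haarProbability G) :=
    Continuous.integrable_of_hasCompactSupport (by fun_prop) (HasCompactSupport.of_compactSpace _)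
  have hi3 : Integrable (fun g => (162 / 625 : ℝ) * x g ^ 4) (haarProbability G) :=
    Continuous.integrable_of_hasCompactSupport (by fun_prop) (HasCompactSupport.of_compactSpace _)
  have hi4 : Integrable (fun g => (1728 / 625 : ℝ) * (x g ^ 2 * y g ^ 2)) (haarProbability G) :=
    Continuous.integrable_of_hasCompactSupport (by fun_prop) (HasCompactSupport.of_compactSpace _)
  have hi5 : Integrable (fun g => (512 / 625 : ℝ) * y g ^ 4) (haarProbability G) :=
    Continuous.integrable_of_hasCompactSupport (by fun_prop) (HasCompactSupport.of_compactSpace _)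
  have hsum : ∫ g, (((3 * x g - 4 * y g) / 5) ^ 4 + ((3 * x g + 4 * y g) / 5) ^ 4) ∂haarProbability G =
      2 * ∫ g, x g ^ 4 ∂haarProbability G := by
    rw [integral_add hi1 hi2, hm, hp]; ring
  have hpt : ∀ g : G, ((3 * x g - 4 * y g) / 5) ^ 4 + ((3 * x g + 4 * y g) / 5) ^ 4 =
      (162 / 625 : ℝ) * x g ^ 4 + (1728 / 625 : ℝ) * (x g ^ 2 * y g ^ 2) + (512 / 625 : ℝ) * y g ^ 4 := by
    intro g; ring
  simp only [hpt] at hsum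
  have hi34 : Integrable (fun g => (162 / 625 : ℝ) * x g ^ 4 + (1728 / 625 : ℝ) * (x g ^ 2 * y g ^ 2))
      (haarProbability G) := hi3.add hi4
  rw [integral_add hi34 hi5, integral_add hi3 hi4, integral_const_mul, integral_const_mul,
    integral_const_mul, hy4] at hsum
  linarith

/-- `∫ (Re U₀₀)² (Im U₀₀)² = (∫ (Re U₀₀)⁴)/3` (rotations by `(3 ± 4i)/5` in the `(x₀, x₁)` plane). [folklore] -/
theorem integral_re00_sq_mul_im00_sq (hρ : IsSpecialUnitaryModel ρ) :
    ∫ g, (ρ g 0 0).re ^ 2 * (ρ g 0 0).im ^ 2 ∂haarProbability G =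
      (∫ g, (ρ g 0 0).re ^ 4 ∂haarProbability G) / 3 := by
  obtain ⟨c0, c1, -, -⟩ := continuous_coords ρ hρ
  refine integral_sq_mul_sq_of_rotations c0 c1 ?_ ?_ (integral_im00_pow_four ρ hρ)
  · have h := integral_comp_quat ρ hρ (a := 3 / 5) (b := 4 / 5) (c := 0) (d := 0) (by norm_num)
      (fun s _ _ _ => s ^ 4)
    have hpt : ∀ g : G, ((3 / 5 : ℝ) * (ρ g 0 0).re - 4 / 5 * (ρ g 0 0).im - 0 * (ρ g 0 1).re - 0 * (ρ g 0 1).im) ^ 4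
        = ((3 * (ρ g 0 0).re - 4 * (ρ g 0 0).im) / 5) ^ 4 := fun g => by ring
    simp only [hpt] at h
    exact h
  · have h := integral_comp_quat ρ hρ (a := 3 / 5) (b := -(4 / 5)) (c := 0) (d := 0) (by norm_num)
      (fun s _ _ _ => s ^ 4)
    have hpt : ∀ g : G,
        ((3 / 5 : ℝ) * (ρ g 0 0).re - -(4 / 5) * (ρ g 0 0).im - 0 * (ρ g 0 1).re - 0 * (ρ g 0 1).im) ^ 4
        = ((3 * (ρ g 0 0).re + 4 * (ρ g 0 0).im) / 5) ^ 4 := fun g => by ring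
    simp only [hpt] at h
    exact h

/-- `∫ (Re U₀₀)² (Re U₀₁)² = (∫ (Re U₀₀)⁴)/3` (rotations by `(3 ± 4j)/5`). [folklore] -/
theorem integral_re00_sq_mul_re01_sq (hρ : IsSpecialUnitaryModel ρ) :
    ∫ g, (ρ g 0 0).re ^ 2 * (ρ g 0 1).re ^ 2 ∂haarProbability G =
      (∫ g, (ρ g 0 0).re ^ 4 ∂haarProbability G) / 3 := by
  obtain ⟨c0, -, c2, -⟩ := continuous_coords ρ hρ
  refine integral_sq_mul_sq_of_rotations c0 c2 ?_ ?_ (integral_re01_pow_four ρ hρ)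
  · have h := integral_comp_quat ρ hρ (a := 3 / 5) (b := 0) (c := 4 / 5) (d := 0) (by norm_num)
      (fun s _ _ _ => s ^ 4)
    have hpt : ∀ g : G, ((3 / 5 : ℝ) * (ρ g 0 0).re - 0 * (ρ g 0 0).im - 4 / 5 * (ρ g 0 1).re - 0 * (ρ g 0 1).im) ^ 4
        = ((3 * (ρ g 0 0).re - 4 * (ρ g 0 1).re) / 5) ^ 4 := fun g => by ring
    simp only [hpt] at h
    exact h
  · have h := integral_comp_quat ρ hρ (a := 3 / 5) (b := 0) (c := -(4 / 5)) (d := 0) (by norm_num)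
      (fun s _ _ _ => s ^ 4)
    have hpt : ∀ g : G,
        ((3 / 5 : ℝ) * (ρ g 0 0).re - 0 * (ρ g 0 0).im - -(4 / 5) * (ρ g 0 1).re - 0 * (ρ g 0 1).im) ^ 4
        = ((3 * (ρ g 0 0).re + 4 * (ρ g 0 1).re) / 5) ^ 4 := fun g => by ring
    simp only [hpt] at h
    exact h

/-- `∫ (Re U₀₀)² (Im U₀₁)² = (∫ (Re U₀₀)⁴)/3` (rotations by `(3 ± 4k)/5`). [folklore] -/
theorem integral_re00_sq_mul_im01_sq (hρ : IsSpecialUnitaryModel ρ) :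
    ∫ g, (ρ g 0 0).re ^ 2 * (ρ g 0 1).im ^ 2 ∂haarProbability G =
      (∫ g, (ρ g 0 0).re ^ 4 ∂haarProbability G) / 3 := by
  obtain ⟨c0, -, -, c3⟩ := continuous_coords ρ hρ
  refine integral_sq_mul_sq_of_rotations c0 c3 ?_ ?_ (integral_im01_pow_four ρ hρ)
  · have h := integral_comp_quat ρ hρ (a := 3 / 5) (b := 0) (c := 0) (d := 4 / 5) (by norm_num)
      (fun s _ _ _ => s ^ 4)
    have hpt : ∀ g : G, ((3 / 5 : ℝ) * (ρ g 0 0).re - 0 * (ρ g 0 0).im - 0 * (ρ g 0 1).re - 4 / 5 * (ρ g 0 1).im) ^ 4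
        = ((3 * (ρ g 0 0).re - 4 * (ρ g 0 1).im) / 5) ^ 4 := fun g => by ring
    simp only [hpt] at h
    exact h
  · have h := integral_comp_quat ρ hρ (a := 3 / 5) (b := 0) (c := 0) (d := -(4 / 5)) (by norm_num)
      (fun s _ _ _ => s ^ 4)
    have hpt : ∀ g : G,
        ((3 / 5 : ℝ) * (ρ g 0 0).re - 0 * (ρ g 0 0).im - 0 * (ρ g 0 1).re - -(4 / 5) * (ρ g 0 1).im) ^ 4
        = ((3 * (ρ g 0 0).re + 4 * (ρ g 0 1).im) / 5) ^ 4 := fun g => by ring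
    simp only [hpt] at h
    exact h

/-! ### The fourth moment -/

/-- **`∫ (Re U₀₀)² dg = 1/4`** (a quarter of the character variance `V₀(SU(2)) = 1`). [folklore] -/
theorem integral_re00_sq (hρ : IsSpecialUnitaryModel ρ) :
    ∫ g, (ρ g 0 0).re ^ 2 ∂haarProbability G = 1 / 4 := by
  have hV := RobustBall.HaarSecondMoments.charVariance_eq_one ρ hρ
  unfold PlaquetteLowerBound.charVariance at hV
  simp_rw [reTr_eq_two_mul ρ hρ, mul_pow] at hV
  rw [integral_const_mul] at hV
  linarith

/-- ★ **THE HAAR FOURTH MOMENT OF AN `SU(2)` ENTRY: `∫ (Re ρ(g)₀₀)⁴ dg = 1/8`** — the fourth moment of a coordinate of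
a uniform point on `S³` (`E[u₀⁴] = 3/(n(n+2)) = 1/8` for `n = 4`). [folklore] -/
theorem integral_re00_pow_four (hρ : IsSpecialUnitaryModel ρ) :
    ∫ g, (ρ g 0 0).re ^ 4 ∂haarProbability G = 1 / 8 := by
  obtain ⟨c0, c1, c2, c3⟩ := continuous_coords ρ hρ
  -- integrate `x₀² · (x₀² + x₁² + x₂² + x₃²) = x₀²`
  have hpt : ∀ g : G, (ρ g 0 0).re ^ 2 =
      (ρ g 0 0).re ^ 4 + (ρ g 0 0).re ^ 2 * (ρ g 0 0).im ^ 2 + (ρ g 0 0).re ^ 2 * (ρ g 0 1).re ^ 2 +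
        (ρ g 0 0).re ^ 2 * (ρ g 0 1).im ^ 2 := by
    intro g
    have h1 := sum_sq_eq_one ρ hρ g
    linear_combination -((ρ g 0 0).re ^ 2 * h1)
  have hq : ∫ g, ((ρ g 0 0).re ^ 4 + (ρ g 0 0).re ^ 2 * (ρ g 0 0).im ^ 2 + (ρ g 0 0).re ^ 2 * (ρ g 0 1).re ^ 2 +
      (ρ g 0 0).re ^ 2 * (ρ g 0 1).im ^ 2) ∂haarProbability G = 1 / 4 := by
    rw [← integral_re00_sq ρ hρ]
    exact integral_congr_ae (Filter.Eventually.of_forall fun g => (hpt g).symm)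
  have hi1 : Integrable (fun g => (ρ g 0 0).re ^ 4) (haarProbability G) :=
    Continuous.integrable_of_hasCompactSupport (by fun_prop) (HasCompactSupport.of_compactSpace _)
  have hi2 : Integrable (fun g => (ρ g 0 0).re ^ 2 * (ρ g 0 0).im ^ 2) (haarProbability G) :=
    Continuous.integrable_of_hasCompactSupport (by fun_prop) (HasCompactSupport.of_compactSpace _)
  have hi3 : Integrable (fun g => (ρ g 0 0).re ^ 2 * (ρ g 0 1).re ^ 2) (haarProbability G) :=
    Continuous.integrable_of_hasCompactSupport (by fun_prop) (HasCompactSupport.of_compactSpace _)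
  have hi4 : Integrable (fun g => (ρ g 0 0).re ^ 2 * (ρ g 0 1).im ^ 2) (haarProbability G) :=
    Continuous.integrable_of_hasCompactSupport (by fun_prop) (HasCompactSupport.of_compactSpace _)
  have hi12 : Integrable (fun g => (ρ g 0 0).re ^ 4 + (ρ g 0 0).re ^ 2 * (ρ g 0 0).im ^ 2) (haarProbability G) :=
    hi1.add hi2
  have hi123 : Integrable (fun g => (ρ g 0 0).re ^ 4 + (ρ g 0 0).re ^ 2 * (ρ g 0 0).im ^ 2 +
      (ρ g 0 0).re ^ 2 * (ρ g 0 1).re ^ 2) (haarProbability G) := hi12.add hi3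
  rw [integral_add hi123 hi4, integral_add hi12 hi3, integral_add hi1 hi2,
    integral_re00_sq_mul_im00_sq ρ hρ, integral_re00_sq_mul_re01_sq ρ hρ, integral_re00_sq_mul_im01_sq ρ hρ] at hq
  linarith

/-- ★★ **THE HAAR FOURTH MOMENT OF THE `SU(2)` CHARACTER: `∫ (Re tr ρ(g))⁴ dg = 2`** for every compact group
`G ≅ SU(2)` — the Catalan number `C₂`, the number of invariants in `V^{⊗4}`. [folklore] -/
theorem integral_reTr_pow_four (hρ : IsSpecialUnitaryModel ρ) :
    ∫ g, PlaquetteLowerBound.reTr ρ g ^ 4 ∂haarProbability G = 2 := by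
  simp_rw [reTr_eq_two_mul ρ hρ, mul_pow]
  rw [integral_const_mul, integral_re00_pow_four ρ hρ]
  norm_num

/-- **`∫ (½ Re tr ρ(g))⁴ dg = 1/8`**: the fourth moment of the `SU(2)` plaquette variable `W = ½ Re tr U` under Haar
measure (second moment `1/4`, so the fourth cumulant is `1/8 − 3/16 = −1/16`). [folklore] -/
theorem integral_half_reTr_pow_four (hρ : IsSpecialUnitaryModel ρ) :
    ∫ g, ((2 : ℝ)⁻¹ * PlaquetteLowerBound.reTr ρ g) ^ 4 ∂haarProbability G = 1 / 8 := by
  simp_rw [mul_pow]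
  rw [integral_const_mul, integral_reTr_pow_four ρ hρ]
  norm_num

/-- **The odd moments vanish: `∫ (Re tr ρ(g))³ dg = 0`** (centre twist by `−1 = quatMatrix (−1)`). [folklore] -/
theorem integral_reTr_pow_three (hρ : IsSpecialUnitaryModel ρ) :
    ∫ g, PlaquetteLowerBound.reTr ρ g ^ 3 ∂haarProbability G = 0 := by
  have h := integral_comp_quat ρ hρ (a := -1) (b := 0) (c := 0) (d := 0) (by norm_num) (fun s _ _ _ => (2 * s) ^ 3)
  have hpt : ∀ g : G, (2 * ((-1 : ℝ) * (ρ g 0 0).re - 0 * (ρ g 0 0).im - 0 * (ρ g 0 1).re - 0 * (ρ g 0 1).im)) ^ 3 =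
      -((2 * (ρ g 0 0).re) ^ 3) := fun g => by ring
  simp only [hpt, integral_neg] at h
  simp_rw [reTr_eq_two_mul ρ hρ]
  linarith

/-- **`∫ Re tr ρ(g) dg = 0`** (centre twist by `−1`). [folklore] -/
theorem integral_reTr (hρ : IsSpecialUnitaryModel ρ) :
    ∫ g, PlaquetteLowerBound.reTr ρ g ∂haarProbability G = 0 := by
  have h := integral_comp_quat ρ hρ (a := -1) (b := 0) (c := 0) (d := 0) (by norm_num) (fun s _ _ _ => 2 * s)
  have hpt : ∀ g : G, 2 * ((-1 : ℝ) * (ρ g 0 0).re - 0 * (ρ g 0 0).im - 0 * (ρ g 0 1).re - 0 * (ρ g 0 1).im) =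
      -(2 * (ρ g 0 0).re) := fun g => by ring
  simp only [hpt, integral_neg] at h
  simp_rw [reTr_eq_two_mul ρ hρ]
  linarith

/-- **`∫ (Re tr ρ(g))² dg = 1`** restated (`charVariance_eq_one`), for uniform citation of the moments `0, 1, 0, 2` of
orders `1, 2, 3, 4`. [folklore] -/
theorem integral_reTr_sq (hρ : IsSpecialUnitaryModel ρ) :
    ∫ g, PlaquetteLowerBound.reTr ρ g ^ 2 ∂haarProbability G = 1 :=
  RobustBall.HaarSecondMoments.charVariance_eq_one ρ hρ

end Model

/-! ### The concrete group `SU(2) = Matrix.specialUnitaryGroup (Fin 2) ℂ` -/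

/-- ★★ **`∫_{SU(2)} (Re tr U)⁴ dU = 2`** in the venture's vocabulary (`fundamentalRep (Fin 2)`). [folklore] -/
theorem integral_reTr_pow_four_su2 :
    ∫ U, ((U : Matrix (Fin 2) (Fin 2) ℂ).trace.re) ^ 4 ∂haarProbability (Matrix.specialUnitaryGroup (Fin 2) ℂ) = 2 := by
  have h := integral_reTr_pow_four (fundamentalRep (Fin 2)) (TorusAreaLaw.isSpecialUnitaryModel_fundamentalRep 2)
  simpa only [PlaquetteLowerBound.reTr, fundamentalRep_apply] using h

/-- ★★ **`∫_{SU(2)} (½ Re tr U)⁴ dU = 1/8`**: the Haar fourth moment of the `SU(2)` plaquette variable. [folklore] -/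
theorem integral_half_reTr_pow_four_su2 :
    ∫ U, ((2 : ℝ)⁻¹ * (U : Matrix (Fin 2) (Fin 2) ℂ).trace.re) ^ 4 ∂haarProbability (Matrix.specialUnitaryGroup (Fin 2) ℂ) =
      1 / 8 := by
  have h := integral_half_reTr_pow_four (fundamentalRep (Fin 2)) (TorusAreaLaw.isSpecialUnitaryModel_fundamentalRep 2)
  simpa only [PlaquetteLowerBound.reTr, fundamentalRep_apply] using h

/-- **`∫_{SU(2)} (Re tr U)³ dU = 0`.** [folklore] -/
theorem integral_reTr_pow_three_su2 :
    ∫ U, ((U : Matrix (Fin 2) (Fin 2) ℂ).trace.re) ^ 3 ∂haarProbability (Matrix.specialUnitaryGroup (Fin 2) ℂ) = 0 := by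
  have h := integral_reTr_pow_three (fundamentalRep (Fin 2)) (TorusAreaLaw.isSpecialUnitaryModel_fundamentalRep 2)
  simpa only [PlaquetteLowerBound.reTr, fundamentalRep_apply] using h

end Summit.Ventures.YMGap.HaarFourthMoment
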